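import Summits.QuantumFields.YangMills.Theorems.VirialFluxGapFixGenericParameters
import Summits.QuantumFields.YangMills.Theorems.VirialFluxGapFixGenericFloor
import Summits.QuantumFields.YangMills.Theorems.VirialFluxGapResolventFieldDivergence
import Summits.QuantumFields.YangMills.Theorems.VirialFluxGapResolventFieldGenericScaled
import HarnessLib

/-!
# Route `VirialFluxGap` (YangMills): the GENERIC PIECE of the patched Euler field in patching letters — drive `Σ_j c¹_j g_j = χ₁·gᵀA⁻¹g` and
# divergence `Σ_j ∂_j c¹_j` of `c¹ := 2·resolventCoeff`, and the pointwise inputs `hg ∕ hdiv₁` of the patching calculus from fcl-p3's (E1)/(E2)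

Toward ⟨stmt-QuantumFields-24141⟩ `VirialFluxGap.PeriodicSoftness` via ✓`FixField.periodicSoftness_of_smoothFrameField_cutoff` (w2 g52) and the
pointwise patching calculus (`FieldPatching.patch_drive ∕ patch_div_le`, w2 g52): the generic chart's coefficients are
`c¹_j := 2·resolventCoeff τ λ⋆ χ₁ j = χ₁·((H + λ⋆1)⁻¹g)_j` (fcl-p3 ✓`resolventCoeff`, with an inner smooth cut-off `χ₁` supported where `H + λ⋆1` is
invertible, so that the coefficients are globally smooth, ✓`contDiff_resolventCoeff`).  This file rewrites fcl-p3's master estimates in exactly the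
letters the patching calculus consumes:

* `sum_resolventPiece_mul_frameGrad` — `Σ_j c¹_j(M)·g_j(M) = χ₁(M)·gᵀ(H + λ⋆1)⁻¹g` (pure algebra);
* `sum_frameD_resolventPiece` — `Σ_j ∂_j c¹_j = Σ_j ∂_jχ₁·(A⁻¹g)_j + χ₁·(tr(A⁻¹H) − Σ_i(A⁻¹B_iA⁻¹g)_i)` at a ring history with `det A ≠ 0`
  (`= 2 ×` ✓`sum_frameD_resolventCoeff`); `frameD_eq_zero_of_eventuallyEq` (a coefficient locally equal to a constant has zero frame derivative);
* ★★★ `generic_piece_pointwise` — at a slice-0 comb-gauged `ρ`-REGULAR point `P` in fcl-p3's polynomial deficit window (hypotheses VERBATIM those of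
  ✓`fix_generic_drive_lower_eps` ∕ ✓`fix_generic_divergence_upper_eps`, `λ⋆ = εκ/3`, `κ = ρ²/(1032960L⁸)`), for any smooth inner cut-off `χ₁` with
  `tsupport χ₁ ⊆ {det(H + λ⋆1) ≠ 0}` which is `≡ 1` near `ringCoord P`:
  (drive) `2(1−ε)·F₀(P) ≤ Σ_j c¹_j g_j`, (pos) `0 ≤ Σ_j c¹_j g_j`, (div) `Σ_j ∂_j c¹_j ≤ (#ι − 4) + ¼` (`= 18L⁴ − ¾` by ✓`card_fixVar_mul_three`) —
  the hypotheses `hg`, `hdiv₁` (with `D = 18L⁴ − ¾`) of `patch_div_le` and `patch_drive` for the generic piece; `det ≠ 0` at `P` comes from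
  ✓`fix_generic_floor_eps` + ✓`isUnit_det_of_floor`.

HONEST FRAMING: rewriting ∕ bookkeeping (theorems only, 0 `def`, 0 `sorry`, standard axioms); the inner cut-off `χ₁`, the central piece, the cross term and
the assembly are NOT here; ⟨24141⟩ and ⟨22884⟩ stay OPEN; no stub ∕ crux ∕ rung ∕ summit is closed; the Yang–Mills mass gap is NOT proved; no summit is
proved by a line.  Width seat `ym-line-sfw-p2-w2` g52 (cell ym-idea-1, free hands), `--supports stmt-QuantumFields-24141`.
References: [cite: Luscher1983, §2]; [cite: Griffiths1964]; [folklore].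
-/

set_option autoImplicit false

noncomputable section

open scoped Matrix BigOperators ContDiff Topology
open MeasureTheory Matrix
open Literature.MathematicalPhysics.QuantumFieldTheory hiding SU2
open Literature.MathematicalPhysics.QuantumLattice
open Literature.MathematicalPhysics.QuantumFieldTheory.SUNBakryEmery (expSU coe_expSU matTop)

namespace Summit.QuantumFields.YangMills.Theorems.VirialFluxGap.FieldPatching

open Summit.QuantumFields.YangMills.Theorems.FemtoTransferGap
open Summit.QuantumFields.YangMills.Theorems.FemtoTransferGap.TT
open Summit.QuantumFields.YangMills.Theorems.FemtoTransferGap.TwoLattice.Flat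
open Summit.QuantumFields.YangMills.Theorems.VirialFluxGap.RingDeficit
open Summit.QuantumFields.YangMills.Theorems.VirialFluxGap.FrameDerivative
open Summit.QuantumFields.YangMills.Theorems.VirialFluxGap.FrameHessian
open Summit.QuantumFields.YangMills.Theorems.VirialFluxGap.ResolventField
open Summit.QuantumFields.YangMills.Theorems.VirialFluxGap.FixFrame

variable {L : ℕ} [NeZero L]
variable {ι : Type*} [Fintype ι] [DecidableEq ι]

open scoped Matrix.Norms.Frobenius

attribute [local instance 2000] Literature.MathematicalPhysics.QuantumFieldTheory.SUNBakryEmery.matTop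

/-! ## §1 The generic coefficients in patching letters -/

/-- ★ **Drive of the generic piece**: `Σ_j (2·resolventCoeff_j)(M)·g_j(M) = χ₁(M)·gᵀ(H + λ⋆1)⁻¹g`. [folklore] -/
theorem sum_resolventPiece_mul_frameGrad (τ : ι → ((Fin (2 * L - 1 + 1) × Edge 3 L) ⊕ Site 3 L) → Matrix (Fin 2) (Fin 2) ℂ) (lam : ℝ)
    (χ₁ : ((Fin (2 * L - 1 + 1) → Edge 3 L → Matrix (Fin 2) (Fin 2) ℂ) × (Site 3 L → Matrix (Fin 2) (Fin 2) ℂ)) → ℝ)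
    (M : (Fin (2 * L - 1 + 1) → Edge 3 L → Matrix (Fin 2) (Fin 2) ℂ) × (Site 3 L → Matrix (Fin 2) (Fin 2) ℂ)) :
    ∑ j, (2 * resolventCoeff (L := L) τ lam χ₁ j M) * frameGrad (L := L) τ M j =
      χ₁ M * (frameGrad (L := L) τ M ⬝ᵥ ((frameHess (L := L) τ M + lam • (1 : Matrix ι ι ℝ))⁻¹ *ᵥ frameGrad (L := L) τ M)) := by
  simp only [resolventCoeff, dotProduct, Finset.mul_sum]
  exact Finset.sum_congr rfl fun j _ => by ring

omit [NeZero L] in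
/-- A function of the coordinates that is locally constant near `M` has zero frame derivative there. [folklore] -/
theorem frameD_eq_zero_of_eventuallyEq {f : ((Fin (2 * L - 1 + 1) → Edge 3 L → Matrix (Fin 2) (Fin 2) ℂ) × (Site 3 L → Matrix (Fin 2) (Fin 2) ℂ)) → ℝ}
    {M : (Fin (2 * L - 1 + 1) → Edge 3 L → Matrix (Fin 2) (Fin 2) ℂ) × (Site 3 L → Matrix (Fin 2) (Fin 2) ℂ)} {a : ℝ} (h : f =ᶠ[𝓝 M] fun _ => a)
    (Y : ((Fin (2 * L - 1 + 1) × Edge 3 L) ⊕ Site 3 L) → Matrix (Fin 2) (Fin 2) ℂ) : frameD Y f M = 0 := by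
  rw [frameD, h.fderiv_eq, fderiv_const_apply]
  simp

/-- ★★ **Divergence of the generic piece** at a ring history with `det(H + λ⋆1) ≠ 0`:
`Σ_j ∂_j(2·resolventCoeff_j) = Σ_j ∂_jχ₁·(A⁻¹g)_j + χ₁·(tr(A⁻¹H) − Σ_i (A⁻¹B_iA⁻¹g)_i)` (`= 2 ×` ✓`sum_frameD_resolventCoeff`). [folklore] -/
theorem sum_frameD_resolventPiece {τ : ι → ((Fin (2 * L - 1 + 1) × Edge 3 L) ⊕ Site 3 L) → Matrix (Fin 2) (Fin 2) ℂ} (hτ : ∀ j w, (τ j w)ᴴ = -τ j w)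
    (hτ0 : ∀ j w, (τ j w).trace = 0) (lam : ℝ)
    {χ₁ : ((Fin (2 * L - 1 + 1) → Edge 3 L → Matrix (Fin 2) (Fin 2) ℂ) × (Site 3 L → Matrix (Fin 2) (Fin 2) ℂ)) → ℝ} (hχ₁ : ContDiff ℝ ∞ χ₁)
    (hsupp : tsupport χ₁ ⊆ {M : ((Fin (2 * L - 1 + 1) → Edge 3 L → Matrix (Fin 2) (Fin 2) ℂ) × (Site 3 L → Matrix (Fin 2) (Fin 2) ℂ)) |
      (frameHess (L := L) τ M + lam • (1 : Matrix ι ι ℝ)).det ≠ 0})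
    (P : ((Fin (2 * L - 1 + 1) → GaugeConfig 3 L SU2) × (Site 3 L → SU2)))
    (hdet : (frameHess (L := L) τ (ringCoord L P) + lam • (1 : Matrix ι ι ℝ)).det ≠ 0) :
    ∑ j, frameD (τ j) (fun M => 2 * resolventCoeff (L := L) τ lam χ₁ j M) (ringCoord L P) =
      (∑ j, frameD (τ j) χ₁ (ringCoord L P) * (((frameHess (L := L) τ (ringCoord L P) + lam • (1 : Matrix ι ι ℝ))⁻¹ *ᵥ
          frameGrad (L := L) τ (ringCoord L P)) j)) +
      χ₁ (ringCoord L P) * (Matrix.trace ((frameHess (L := L) τ (ringCoord L P) + lam • (1 : Matrix ι ι ℝ))⁻¹ *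
            frameHess (L := L) τ (ringCoord L P)) -
        ∑ j, ((frameHess (L := L) τ (ringCoord L P) + lam • (1 : Matrix ι ι ℝ))⁻¹ *ᵥ
          ((fun j' k => frameD (τ j) (fun M => frameHess (L := L) τ M j' k) (ringCoord L P)) *ᵥ
            ((frameHess (L := L) τ (ringCoord L P) + lam • (1 : Matrix ι ι ℝ))⁻¹ *ᵥ frameGrad (L := L) τ (ringCoord L P)))) j) := by
  have hsm : ∀ j, ContDiff ℝ ∞ (resolventCoeff (L := L) τ lam χ₁ j) := fun j => contDiff_resolventCoeff τ lam hχ₁ hsupp j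
  have h2 : ∀ j, frameD (τ j) (fun M => 2 * resolventCoeff (L := L) τ lam χ₁ j M) (ringCoord L P) =
      2 * frameD (τ j) (resolventCoeff (L := L) τ lam χ₁ j) (ringCoord L P) := fun j => frameD_const_mul (τ j) (hsm j) 2 (ringCoord L P)
  rw [Finset.sum_congr rfl fun j _ => h2 j, ← Finset.mul_sum, sum_frameD_resolventCoeff hτ hτ0 lam hχ₁ hsupp P hdet]
  simp only [Finset.mul_sum, mul_add, mul_sub]
  congr 1
  · exact Finset.sum_congr rfl fun j _ => by ring
  · ring_nf

/-! ## §2 The pointwise inputs of the patching calculus for the generic piece -/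

/-- ★★★ **The generic piece, pointwise, in patching letters.**  At a slice-0 comb-gauged `ρ`-regular ring history `P` in the polynomial deficit
window of ✓`fix_generic_drive_lower_eps` (`λ⋆ = εκ/3`, `κ = ρ²/(1032960L⁸)`), for a smooth inner cut-off `χ₁` with `tsupport χ₁ ⊆ {det(H + λ⋆1) ≠ 0}`
and `χ₁ ≡ 1` near `ringCoord P`, the coefficients `c¹_j := 2·resolventCoeff fixFrameStd λ⋆ χ₁ j` satisfy
(drive) `2(1−ε)F₀(P) ≤ Σ_j c¹_j g_j`, (pos) `0 ≤ Σ_j c¹_j g_j`, (div) `Σ_j ∂_j c¹_j ≤ (#ι − 4) + ¼`. [cite: Luscher1983, §2] -/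
theorem generic_piece_pointwise [DecidableEq (FixVar L × Fin 3)] (P : ((Fin (2 * L - 1 + 1) → GaugeConfig 3 L SU2) × (Site 3 L → SU2)))
    (hP : ∀ e : Edge 3 L, treeEdge e = true → P.1 0 e = 1) {ρ : ℝ} (hρ : 0 < ρ)
    (hfar : (∃ k : Fin 3, ρ ^ 2 ≤ 1 - (su2Quat (wrapReps (P.1 0) k)).re ^ 2) ∨ ρ ^ 2 ≤ 1 - (su2Quat (P.2 0)).re ^ 2)
    (hsmall : 224 * (L : ℝ) ^ 2 * Real.sqrt (ringDeficit L (fun _ => false) P) < ρ)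
    {K ε : ℝ} (hK : 0 ≤ K) (hε : 0 < ε) (hε1 : ε ≤ 1)
    (hK3 : ∀ (Y₁ Y₂ Y₃ : ((Fin (2 * L - 1 + 1) × Edge 3 L) ⊕ Site 3 L) → Matrix (Fin 2) (Fin 2) ℂ) (b₁ b₂ b₃ : ℝ), 0 ≤ b₁ → 0 ≤ b₂ → 0 ≤ b₃ →
      (∀ w, ‖Y₁ w‖ ≤ b₁) → (∀ w, ‖Y₂ w‖ ≤ b₂) → (∀ w, ‖Y₃ w‖ ≤ b₃) → ∀ Q : ((Fin (2 * L - 1 + 1) → GaugeConfig 3 L SU2) × (Site 3 L → SU2)),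
      |frameD Y₁ (frameD Y₂ (frameD Y₃ (ringPoly L))) (ringCoord L Q)| ≤ K * b₁ * b₂ * b₃)
    (hD : 1032960 * (L : ℝ) ^ 8 * ringDeficit L (fun _ => false) P / ρ ^ 2 ≤
      ε ^ 3 * (ρ ^ 2 / (1032960 * (L : ℝ) ^ 8)) ^ 2 / (10000 * (K + 1) ^ 2 * (Fintype.card (FixVar L × Fin 3) : ℝ) ^ 5))
    {lam : ℝ} (hlam : lam = ε * (ρ ^ 2 / (1032960 * (L : ℝ) ^ 8)) / 3)
    {χ₁ : ((Fin (2 * L - 1 + 1) → Edge 3 L → Matrix (Fin 2) (Fin 2) ℂ) × (Site 3 L → Matrix (Fin 2) (Fin 2) ℂ)) → ℝ} (hχ₁ : ContDiff ℝ ∞ χ₁)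
    (hsupp : tsupport χ₁ ⊆ {M : ((Fin (2 * L - 1 + 1) → Edge 3 L → Matrix (Fin 2) (Fin 2) ℂ) × (Site 3 L → Matrix (Fin 2) (Fin 2) ℂ)) |
      (frameHess (L := L) fixFrameStd M + lam • (1 : Matrix (FixVar L × Fin 3) (FixVar L × Fin 3) ℝ)).det ≠ 0})
    (hone : χ₁ =ᶠ[𝓝 (ringCoord L P)] fun _ => 1) :
    2 * (1 - ε) * ringDeficit L (fun _ => false) P ≤
        ∑ j, (2 * resolventCoeff (L := L) fixFrameStd lam χ₁ j (ringCoord L P)) * frameGrad (L := L) fixFrameStd (ringCoord L P) j ∧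
      0 ≤ ∑ j, (2 * resolventCoeff (L := L) fixFrameStd lam χ₁ j (ringCoord L P)) * frameGrad (L := L) fixFrameStd (ringCoord L P) j ∧
      ∑ j, frameD (fixFrameStd j) (fun M => 2 * resolventCoeff (L := L) fixFrameStd lam χ₁ j M) (ringCoord L P) ≤
        ((Fintype.card (FixVar L × Fin 3) : ℝ) - 4) + 1 / 4 := by
  subst hlam
  have hχ1 : χ₁ (ringCoord L P) = 1 := hone.self_of_nhds
  -- invertibility at `P` from the floor
  have hfloor := fix_generic_floor_eps P hP hρ hfar hsmall hK hε hε1 hK3 hD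
  have hL0 : (0 : ℝ) < L := by exact_mod_cast NeZero.pos L
  have hc0 : 0 < (ε * (ρ ^ 2 / (1032960 * (L : ℝ) ^ 8)) / 3) / 2 := by positivity
  have hdet : (frameHess (L := L) fixFrameStd (ringCoord L P) + (ε * (ρ ^ 2 / (1032960 * (L : ℝ) ^ 8)) / 3) •
      (1 : Matrix (FixVar L × Fin 3) (FixVar L × Fin 3) ℝ)).det ≠ 0 := (isUnit_det_of_floor hc0 hfloor).ne_zero
  -- drive
  have hE1 := fix_generic_drive_lower_eps P hP hρ hfar hsmall hK hε hε1 hK3 hD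
  have hdrive : 2 * (1 - ε) * ringDeficit L (fun _ => false) P ≤
      ∑ j, (2 * resolventCoeff (L := L) fixFrameStd (ε * (ρ ^ 2 / (1032960 * (L : ℝ) ^ 8)) / 3) χ₁ j (ringCoord L P)) *
        frameGrad (L := L) fixFrameStd (ringCoord L P) j := by
    rw [sum_resolventPiece_mul_frameGrad, hχ1, one_mul]
    linarith
  have hF0 : 0 ≤ ringDeficit L (fun _ => false) P := ringDeficit_nonneg _ _
  refine ⟨hdrive, le_trans (by nlinarith) hdrive, ?_⟩
  -- divergence
  have hE2 := fix_generic_divergence_upper_eps P hP hρ hfar hsmall hK hε hε1 hK3 hD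
  rw [sum_frameD_resolventPiece fixFrameStd_conjTranspose fixFrameStd_trace _ hχ₁ hsupp P hdet, hχ1, one_mul]
  have hzero : ∀ j, frameD (fixFrameStd j) χ₁ (ringCoord L P) = 0 := fun j => frameD_eq_zero_of_eventuallyEq hone _
  simp only [hzero, zero_mul, Finset.sum_const_zero, zero_add]
  linarith

end Summit.QuantumFields.YangMills.Theorems.VirialFluxGap.FieldPatching

end
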